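import Mathlib
import HarnessLib
import Literature.Probability.Percolation.MinOpenCut
import Literature.Probability.Percolation.MinOpenCutMenger

/-!
# Crossing clusters versus the min-cut budget (line `Sketch`, crux `BudgetTightness`,
# stmt-CriticalPhenomena-5248): `#{open clusters of S meeting A and B} ≤ MinCut_S(A, B)`

The DENSITY half of the open core of line `Sketch`: the number `N_S(A,B)(ω)` of connected
components of the open graph induced on a region `S` that contain a vertex of `A` and a vertex of
`B` is at most the maximal number of pairwise edge-disjoint open `A`–`B` walks inside `S` (one walk
per component; walks in distinct components share no vertex, hence no edge), hence at most the
min-cut budget `minOpenCutIn S A B ω` (weak duality, `maxDisjointOpenPathsIn_le_minOpenCutIn`).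
Consequently every upper bound on `E[MinCut]` — in particular the core statement
`SlabCutQuadraticIO(p_c)` of the line — implies the same bound for the expected number of crossing
clusters ("tight spanning-cluster number", the hyperscaling statement of Aizenman 1997 / BCKS 1999 in
slab form), which is therefore a NECESSARY condition for the crux (`integral_numCrossing_le`).
-/

noncomputable section

namespace Summit.CriticalPhenomena.PercolationContinuityZ3.Theorems.BudgetTightness

open MeasureTheory
open Literature.Probability.Percolation Literature.Probability.LatticeModels

namespace CoreDensity

variable {V : Type*}

/-- The set of **crossing components**: connected components of the open graph of `ω` induced on
`S` containing a vertex of `A` and a vertex of `B`. -/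
theorem mem_crossingComponents_iff {S A B : Set V} {ω : BondConfig V}
    {c : ((openGraph ω).induce S).ConnectedComponent} :
    c ∈ {c : ((openGraph ω).induce S).ConnectedComponent |
        (∃ x : S, (x : V) ∈ A ∧ ((openGraph ω).induce S).connectedComponentMk x = c) ∧
        ∃ y : S, (y : V) ∈ B ∧ ((openGraph ω).induce S).connectedComponentMk y = c} ↔
      (∃ x : S, (x : V) ∈ A ∧ ((openGraph ω).induce S).connectedComponentMk x = c) ∧
        ∃ y : S, (y : V) ∈ B ∧ ((openGraph ω).induce S).connectedComponentMk y = c :=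
  Iff.rfl

/-- A vertex on a walk lies in the connected component of the walk's start. -/
theorem connectedComponentMk_eq_of_mem_support {G : SimpleGraph V} {u v w : V} (p : G.Walk u v)
    (hw : w ∈ p.support) : G.connectedComponentMk w = G.connectedComponentMk u := by
  classical
  rw [SimpleGraph.ConnectedComponent.eq]
  exact ⟨(p.takeUntil w hw).reverse⟩

/-- **Crossing components are at most the path-packing number**: for a finite region,
`#{components meeting A and B} ≤ maxDisjointOpenPathsIn S A B ω` (one open walk per component;
walks of distinct components are vertex-disjoint, hence edge-disjoint). -/
theorem encard_crossingComponents_le_maxDisjointOpenPathsIn {S : Set V} (hS : S.Finite)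
    (A B : Set V) (ω : BondConfig V) :
    {c : ((openGraph ω).induce S).ConnectedComponent |
        (∃ x : S, (x : V) ∈ A ∧ ((openGraph ω).induce S).connectedComponentMk x = c) ∧
        ∃ y : S, (y : V) ∈ B ∧ ((openGraph ω).induce S).connectedComponentMk y = c}.encard ≤
      maxDisjointOpenPathsIn S A B ω := by
  classical
  set H : SimpleGraph S := (openGraph ω).induce S
  set K := {c : H.ConnectedComponent |
        (∃ x : S, (x : V) ∈ A ∧ H.connectedComponentMk x = c) ∧
        ∃ y : S, (y : V) ∈ B ∧ H.connectedComponentMk y = c}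
  haveI : Finite S := hS.to_subtype
  have hKf : K.Finite := Set.toFinite K
  -- enumerate the crossing components
  set n := hKf.toFinset.card
  obtain ⟨e⟩ : Nonempty (Fin n ≃ hKf.toFinset) := ⟨hKf.toFinset.equivFin.symm⟩
  have hmem : ∀ i : Fin n, (e i : H.ConnectedComponent) ∈ K := fun i =>
    hKf.mem_toFinset.1 (e i).2
  -- endpoints and walks
  choose x hxA hxc using fun i => (hmem i).1
  choose y hyB hyc using fun i => (hmem i).2
  have hreach : ∀ i, H.Reachable (x i) (y i) := fun i =>
    SimpleGraph.ConnectedComponent.eq.1 ((hxc i).trans (hyc i).symm)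
  have P : ∀ i, H.Walk (x i) (y i) := fun i => (hreach i).some
  have hle := le_maxDisjointOpenPathsIn (S := S) (A := A) (B := B) (ω := ω) x y P
    (fun i => ⟨hxA i, hyB i⟩) (by
      intro i j hij e' hei hej
      -- a common edge gives a common vertex, hence a common component
      induction e' using Sym2.ind with
      | h u w =>
        have hui : u ∈ (P i).support := SimpleGraph.Walk.fst_mem_support_of_mem_edges _ hei
        have huj : u ∈ (P j).support := SimpleGraph.Walk.fst_mem_support_of_mem_edges _ hej
        have hi := connectedComponentMk_eq_of_mem_support (P i) hui
        have hj := connectedComponentMk_eq_of_mem_support (P j) huj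
        have : (e i : H.ConnectedComponent) = e j := by
          rw [← hxc i, ← hxc j, ← hi, ← hj]
        exact hij (e.injective (Subtype.ext this)))
  calc K.encard = (n : ℕ∞) := by
        rw [hKf.encard_eq_coe_toFinset_card]
    _ ≤ maxDisjointOpenPathsIn S A B ω := hle

/-- **Crossing components are at most the min-cut budget** (weak duality). -/
theorem encard_crossingComponents_le_minOpenCutIn {S : Set V} (hS : S.Finite)
    (A B : Set V) (ω : BondConfig V) :
    {c : ((openGraph ω).induce S).ConnectedComponent |
        (∃ x : S, (x : V) ∈ A ∧ ((openGraph ω).induce S).connectedComponentMk x = c) ∧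
        ∃ y : S, (y : V) ∈ B ∧ ((openGraph ω).induce S).connectedComponentMk y = c}.encard ≤
      minOpenCutIn S A B ω :=
  (encard_crossingComponents_le_maxDisjointOpenPathsIn hS A B ω).trans
    (maxDisjointOpenPathsIn_le_minOpenCutIn S A B ω)

/-- **In expectation**: `E[#crossing components] ≤ E[MinCut]` for a finite region under any measure
for which the budget is integrable (no measurability of the left side is needed:
`integral_mono_of_nonneg`). -/
theorem integral_numCrossing_le {S : Set V} (hS : S.Finite) (A B : Set V)
    (μ : Measure (BondConfig V))
    (hint : Integrable (fun ω => ((minOpenCutIn S A B ω).toNat : ℝ)) μ)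
    (hfin : ∀ ω, minOpenCutIn S A B ω ≠ ⊤) :
    ∫ ω, (({c : ((openGraph ω).induce S).ConnectedComponent |
        (∃ x : S, (x : V) ∈ A ∧ ((openGraph ω).induce S).connectedComponentMk x = c) ∧
        ∃ y : S, (y : V) ∈ B ∧ ((openGraph ω).induce S).connectedComponentMk y = c}.encard).toNat : ℝ)
        ∂μ ≤
      ∫ ω, ((minOpenCutIn S A B ω).toNat : ℝ) ∂μ := by
  refine integral_mono_of_nonneg (Filter.Eventually.of_forall fun ω => Nat.cast_nonneg _) hint
    (Filter.Eventually.of_forall fun ω => ?_)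
  dsimp only
  exact_mod_cast ENat.toNat_le_toNat (encard_crossingComponents_le_minOpenCutIn hS A B ω) (hfin ω)

end CoreDensity

/-- **`stub_numCrossingLe` (registered stub of line `Sketch`, crux stmt-CriticalPhenomena-5248):**
for every finite region of `ℤ³`, the number of open clusters (connected components of the open graph
induced on the region) meeting both `A` and `B` is at most the min-cut budget `MinCut_S(A,B)`. -/
theorem stub_numCrossingLe :
    ∀ (S A B : Set (Site 3)), S.Finite → ∀ ω : BondConfig (Site 3),
      {c : ((openGraph ω).induce S).ConnectedComponent |
        (∃ x : S, (x : Site 3) ∈ A ∧ ((openGraph ω).induce S).connectedComponentMk x = c) ∧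
        ∃ y : S, (y : Site 3) ∈ B ∧ ((openGraph ω).induce S).connectedComponentMk y = c}.encard ≤
      minOpenCutIn S A B ω :=
  fun _ A B hS ω => CoreDensity.encard_crossingComponents_le_minOpenCutIn hS A B ω

end Summit.CriticalPhenomena.PercolationContinuityZ3.Theorems.BudgetTightness

end
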